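import Summits.ResolutionOfSingularities.ResolutionOfSingularities.Theorems.FrobeniusLadderFRationalResolutionChartMonoidFG
import Summits.ResolutionOfSingularities.ResolutionOfSingularities.Theorems.FrobeniusLadderFRationalResolutionLogChartTransport
import Summits.ResolutionOfSingularities.ResolutionOfSingularities.Theorems.FrobeniusLadderFRationalResolutionKernelLattice
import Mathlib.GroupTheory.Subgroup.Saturated
import Mathlib.GroupTheory.Finiteness
import HarnessLib

/-!
# Crux `FrobeniusLadder.FRationalResolution` (stmt-ResolutionOfSingularities-15317), line `redirect`,
# stub `stub_diagonalizableQuotientResolution` — CHART NORMALISATION (census item R4, assembled): the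
# monomial chart of the log-regularity milestone can be re-parametrised to a finitely generated,
# SATURATED, SPANNING chart monoid `P' ⊆ ℤⁿ` with the same Kato condition

The milestone `…FixedPointLogRegular.exists_isLogRegularAt_of_fixed` produces a chart on
`P = ℤⁿ_{≥0} ⊓ ker(m ↦ Σ mᵢ aᵢ)`, which does not span `ℤⁿ` and is not saturated in `ℤⁿ` (only in
its own group). The tree's atlases (`LogAtlas`, `EtaleLogAtlas`, Nizioł/Kato resolution) want
`fg`, `NSMulSaturated` and `span = ⊤`. Pulling `P` back along a `ℤ`-basis `L : ℤⁿ ≅ ker` of the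
exponent lattice (`…KernelLattice`) gives such a `P'`, isomorphic to `P` as a monoid, and Kato's
condition is unchanged (`…LogChartTransport`):

* `span_eq_ker` — `P` generates the exponent lattice: `span ℤ P = ker(m ↦ Σ mᵢ aᵢ)`;
* `exists_normalized_chart` — **for every chart `φ : P → A` and prime `𝔭` there are `P' ⊆ ℤⁿ`
  finitely generated, saturated and spanning, a monoid isomorphism `e : P' ≃ P`, and
  `IsLogRegularAt P' (φ ∘ e) 𝔭 ↔ IsLogRegularAt P φ 𝔭`.**

Honest label: R4 of the census, done up to plugging into an atlas (no stub closed). No definitions,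
no named facts, no sorry. [cite: Kato1994, (1.5), Def. (2.1)]
-/

-- single-problem summit: the doubled namespace component is forced
set_option linter.dupNamespace false

open Literature.AlgebraicGeometry.Resolution

namespace Summit.ResolutionOfSingularities.ResolutionOfSingularities.Theorems.FRationalResolution.ChartNormalization

universe u w

variable {A' : Type w} [AddCommGroup A'] {n : ℕ} (a : Fin n → A')

/-- Membership in `P = ℤⁿ_{≥0} ⊓ ker`. -/
theorem mem_chartMonoid_iff (m : Fin n → ℤ) :
    m ∈ (AddSubmonoid.nonneg (Fin n → ℤ) ⊓
      AddMonoidHom.mker (Fintype.linearCombination ℤ a).toAddMonoidHom) ↔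
      0 ≤ m ∧ Fintype.linearCombination ℤ a m = 0 := by
  rw [AddSubmonoid.mem_inf, AddSubmonoid.mem_nonneg, AddMonoidHom.mem_mker,
    LinearMap.toAddMonoidHom_coe]

/-- **`P = ℤⁿ_{≥0} ⊓ ker` generates the exponent lattice**: every `v ∈ ker(m ↦ Σ mᵢ aᵢ)` is
`(v + N w) − N w` with both summands in `P`, for `N = ∏ ord aᵢ` and `w ≫ 0`. [folklore] -/
theorem span_eq_ker (ha : ∀ i, IsOfFinAddOrder (a i)) :
    Submodule.span ℤ ((AddSubmonoid.nonneg (Fin n → ℤ) ⊓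
        AddMonoidHom.mker (Fintype.linearCombination ℤ a).toAddMonoidHom : AddSubmonoid (Fin n → ℤ)) :
        Set (Fin n → ℤ)) = LinearMap.ker (Fintype.linearCombination ℤ a) := by
  classical
  apply le_antisymm
  · rw [Submodule.span_le]
    intro m hm
    exact ((mem_chartMonoid_iff a m).mp hm).2
  · intro v hv
    rw [LinearMap.mem_ker] at hv
    set N : ℤ := ∏ i, (addOrderOf (a i) : ℤ) with hN
    have hNker : ∀ w : Fin n → ℤ, Fintype.linearCombination ℤ a (N • w) = 0 := fun w =>
      KernelLattice.range_smul_le_ker a ha ⟨w, rfl⟩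
    have hNpos : 0 < N :=
      Finset.prod_pos fun i _ => by exact_mod_cast (ha i).addOrderOf_pos
    -- a large constant vector
    set c : ℤ := ∑ i, |v i| with hc
    have hcv : ∀ i, -v i ≤ c := fun i =>
      (neg_le_abs (v i)).trans (Finset.single_le_sum (fun j _ => abs_nonneg (v j)) (Finset.mem_univ i))
    have hc0 : 0 ≤ c := Finset.sum_nonneg fun i _ => abs_nonneg (v i)
    let w : Fin n → ℤ := fun _ => c
    have hw : N • w ∈ (AddSubmonoid.nonneg (Fin n → ℤ) ⊓
        AddMonoidHom.mker (Fintype.linearCombination ℤ a).toAddMonoidHom) := by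
      rw [mem_chartMonoid_iff]
      refine ⟨fun i => ?_, hNker w⟩
      simp only [w, Pi.smul_apply, smul_eq_mul, Pi.zero_apply]
      positivity
    have hu : v + N • w ∈ (AddSubmonoid.nonneg (Fin n → ℤ) ⊓
        AddMonoidHom.mker (Fintype.linearCombination ℤ a).toAddMonoidHom) := by
      rw [mem_chartMonoid_iff]
      refine ⟨fun i => ?_, by rw [map_add, hv, hNker, add_zero]⟩
      simp only [w, Pi.add_apply, Pi.smul_apply, smul_eq_mul, Pi.zero_apply]
      have h1 := hcv i
      nlinarith
    have hvw : v = (v + N • w) - N • w := by simp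
    rw [hvw]
    exact Submodule.sub_mem _ (Submodule.subset_span hu) (Submodule.subset_span hw)

/-- **Chart normalisation.** For `aᵢ` of finite order, every chart `φ` on
`P = ℤⁿ_{≥0} ⊓ ker(m ↦ Σ mᵢ aᵢ)` can be re-parametrised along a monoid isomorphism `e : P' ≃ P`
with `P' ⊆ ℤⁿ` FINITELY GENERATED, SATURATED in `ℤⁿ` and SPANNING `ℤⁿ` (`P' = L⁻¹ P` for a
`ℤ`-basis `L : ℤⁿ ≅ ker`), without changing Kato's condition at any prime.
[cite: Kato1994, (1.5), Def. (2.1)] -/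
theorem exists_normalized_chart {A : Type u} [CommRing A] (ha : ∀ i, IsOfFinAddOrder (a i))
    (φ : Multiplicative ↥(AddSubmonoid.nonneg (Fin n → ℤ) ⊓
      AddMonoidHom.mker (Fintype.linearCombination ℤ a).toAddMonoidHom) →* A)
    (𝔭 : Ideal A) [𝔭.IsPrime] :
    ∃ (P' : AddSubmonoid (Fin n → ℤ))
      (e : ↥P' ≃+ ↥(AddSubmonoid.nonneg (Fin n → ℤ) ⊓
        AddMonoidHom.mker (Fintype.linearCombination ℤ a).toAddMonoidHom)),
      P'.FG ∧ P'.NSMulSaturated ∧ Submodule.span ℤ (P' : Set (Fin n → ℤ)) = ⊤ ∧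
      (LogChart.IsLogRegularAt P' (φ.comp (AddMonoidHom.toMultiplicative e.toAddMonoidHom)) 𝔭 ↔
        LogChart.IsLogRegularAt _ φ 𝔭) := by
  classical
  have hfgP := ChartMonoidFG.fg_nonneg_inf_mker a ha
  have hspanP := span_eq_ker a ha
  have hmemP := mem_chartMonoid_iff a
  generalize (AddSubmonoid.nonneg (Fin n → ℤ) ⊓
    AddMonoidHom.mker (Fintype.linearCombination ℤ a).toAddMonoidHom) = P at φ hfgP hspanP hmemP ⊢
  obtain ⟨L, hL, hrange⟩ := KernelLattice.exists_linearMap_range_eq_ker a ha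
  let P' : AddSubmonoid (Fin n → ℤ) := P.comap L.toAddMonoidHom
  -- the monoid isomorphism `P' ≃ P`
  let f : ↥P' →+ ↥P :=
    { toFun := fun p' => ⟨L p'.1, p'.2⟩
      map_zero' := Subtype.ext (map_zero L)
      map_add' := fun x y => Subtype.ext (map_add L x.1 y.1) }
  have hfinj : Function.Injective f := fun x y h =>
    Subtype.ext (hL (congrArg Subtype.val h))
  have hfsurj : Function.Surjective f := by
    rintro ⟨p, hp⟩
    have hpker : p ∈ LinearMap.ker (Fintype.linearCombination ℤ a) :=
      ((hmemP p).mp hp).2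
    rw [← hrange] at hpker
    obtain ⟨v, hv⟩ := hpker
    refine ⟨⟨v, show L.toAddMonoidHom v ∈ P by rw [LinearMap.toAddMonoidHom_coe, hv]; exact hp⟩,
      Subtype.ext hv⟩
  let e : ↥P' ≃+ ↥P := AddEquiv.ofBijective f ⟨hfinj, hfsurj⟩
  have heL : ∀ p' : ↥P', L p'.1 = (e p').1 := fun p' => rfl
  have himage : L '' (P' : Set (Fin n → ℤ)) = (P : Set (Fin n → ℤ)) := by
    ext p
    constructor
    · rintro ⟨v, hv, rfl⟩
      exact hv
    · intro hp
      obtain ⟨⟨v, hv⟩, hvp⟩ := hfsurj ⟨p, hp⟩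
      exact ⟨v, hv, congrArg Subtype.val hvp⟩
  refine ⟨P', e, ?_, ?_, ?_, ?_⟩
  · -- finitely generated
    haveI : AddMonoid.FG ↥P := (AddMonoid.fg_iff_addSubmonoid_fg P).mpr hfgP
    have hfg' : AddMonoid.FG ↥P' := AddMonoid.fg_of_surjective e.symm.toAddMonoidHom e.symm.surjective
    exact (AddMonoid.fg_iff_addSubmonoid_fg P').mp hfg'
  · -- saturated
    intro k v hkv
    by_cases hk : k = 0
    · exact Or.inl hk
    · right
      change L.toAddMonoidHom (k • v) ∈ P at hkv
      change L.toAddMonoidHom v ∈ P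
      rw [LinearMap.toAddMonoidHom_coe] at hkv ⊢
      rw [map_nsmul] at hkv
      obtain ⟨hnn, -⟩ := (hmemP _).mp hkv
      rw [hmemP]
      refine ⟨fun i => ?_, ?_⟩
      · have h := hnn i
        simp only [Pi.smul_apply, nsmul_eq_mul, Pi.zero_apply] at h
        have hkpos : (0 : ℤ) < k := by exact_mod_cast Nat.pos_of_ne_zero hk
        exact (mul_nonneg_iff_of_pos_left hkpos).mp h
      · have hmem : L v ∈ LinearMap.range L := ⟨v, rfl⟩
        rw [hrange] at hmem
        exact hmem
  · -- spanning
    apply Submodule.map_injective_of_injective hL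
    rw [Submodule.map_span, himage, hspanP, ← hrange, Submodule.map_top]
  · exact LogChartTransport.isLogRegularAt_comp_iff P P' e φ L hL heL 𝔭

end Summit.ResolutionOfSingularities.ResolutionOfSingularities.Theorems.FRationalResolution.ChartNormalization
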